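import Literature.MathematicalPhysics.QuantumLattice.ApproximatingHamiltonianProofs
import HarnessLib
import HarnessLib.Audit

/-!
# Hubbard ladder — Bounds: the Kubo-curvature (thermal current-moment) stiffness ceiling,
# part 1 of 2 — the finite-dimensional engine

HONEST FRAMING (cell pub-hubbard): ladder R1–R4 with certified numbers; no claim on H/H₀. This is
a bound for a MODEL CLASS (finite-dimensional Gibbs states of Hermitian matrices; instantiated in
part 2, `ThermalStiffnessCeilingCurrentMoments.lean`, for the `t–t'` Hubbard torus in its
canonical sectors), no materials claim. Companion text: `pub-hubbard/paper/bounds.tex` Thm 5′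
("thermal current moments"); table `pub-hubbard/pub-hubbard-bounds/BOUNDS.md` row T1g.

## What is proved here (no `sorry`, no new axioms)

`KuboCurvatureStiffnessCeiling` (`@[conjecture] def`, PROVED by
`kuboCurvatureStiffnessCeiling_holds` from `stiffness_le_half_kin_sub_duhamel`): for Hermitian
`H, K, J` on a nonempty finite index type, `β > 0`, `θ₀ > 0`, `c ≠ 0`, if the free energy is stiff
along the TWO-TERM flux curve `H(θ) = H + (1 − cos(θc)) K + sin(θc) J`,
`β ρ θ² ≤ log Z_β(H) − log Z_β(H(θ))` for `|θ| ≤ θ₀`, then `⟨J⟩_β = 0` and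

  `ρ ≤ c² (½ ⟨K⟩_β − (β/2) (J, J)_β)`,

where `(J, J)_β = duhamel β H J J = Z⁻¹ ∫₀¹ Tr(J e^{−sβH} J e^{−(1−s)βH}) ds ≥ 0` is the Duhamel
(Bogoliubov–Kubo–Mori) two-point function of the tree (`DuhamelTwoPoint.lean`). In words: an
admissible stiffness coefficient is at most half the curvature of the free energy, and the
curvature is the finite-volume Kubo formula "diamagnetic (kinetic) term minus paramagnetic
current–current response" (`D_s/π = ⟨−k_x⟩ − Λ_xx` of Scalapino–White–Zhang §II, here as an
INEQUALITY, in finite volume, for every admissible `ρ`). It strictly sharpens the kinetic-energy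
bound (`D_s(T) ≤ D̃(T)`, Hazra–Verma–Randeria eq. (2); tree:
`thermalStiffnessTT'_mul_sq_le_kinetic`) by the nonnegative paramagnetic term and needs no sign
hypothesis on `ρ`.

Proof (all in Lean). Peierls–Bogoliubov (`log_partitionFn_sub_le_log_partitionFn_add`) at the
base point `H + sin(θc) J` peels off the `K`-term, leaving the one-variable function
`g(θ) = log Tr e^{A + sin(θc) Y} − β (1 − cos(θc)) ⟨K⟩_{H + sin(θc) J} + β ρ θ² − log Tr e^{A}`
(`A = −βH`, `Y = −βJ`) with `g ≤ 0 = g(0)` on `[−θ₀, θ₀]`. Its derivative exists everywhere and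
is differentiable at `0` by the tree's Duhamel calculus (`hasDerivAt_re_trace_exp_add_smul`,
`hasDerivAt_trace_mul_exp_add_smul`) plus the product rule for `u·v` with `u(0) = u'(0) = 0` and
`v` merely continuous (`hasDerivAt_mul_of_hasDerivAt_zero`); a local maximum of such a function
has `g'(0) = 0` (whence `⟨J⟩ = 0`) and `g''(0) ≤ 0` (`deriv2_nonpos_of_eventually_le`, from
Mathlib's `isLocalMin_of_deriv_deriv_pos`), and
`g''(0) = c² (β² Z⁻¹ ∫₀¹ Tr(J e^{−sβH} J e^{−(1−s)βH}) ds − β ⟨K⟩) + 2βρ`.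

References (keys of `lean/references.bib`): ScalapinoWhiteZhang1993 §II (Kubo formula for `D_s`);
DLS1978 §3 (Duhamel two-point function); HazraVermaRanderia2019 eq. (2);
ParamekantiTrivediRanderia1998 eq. (3) and §IV.
-/

noncomputable section

namespace Summit.HubbardSuperconductivity.HubbardLadder.Bounds

open Matrix Finset MeasureTheory intervalIntegral Filter Topology NormedSpace Asymptotics
open Literature.MathematicalPhysics.QuantumLattice
open scoped ComplexOrder ComplexConjugate Matrix.Norms.L2Operator

variable {m : Type*} [Fintype m] [DecidableEq m]

/-! ### One-variable matrix calculus along `t ↦ A + tY` -/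

/-- `d/dt Re Tr(K e^{A+tY}) = Re ∫₀¹ Tr(K e^{s(A+tY)} Y e^{(1−s)(A+tY)}) ds` (real part of the
tree's `hasDerivAt_trace_mul_exp_add_smul`). [folklore] -/
theorem hasDerivAt_re_trace_const_mul_exp_add_smul (K A Y : Matrix m m ℂ) (t₀ : ℝ) :
    HasDerivAt (fun t : ℝ => (K * exp (A + t • Y)).trace.re)
      (∫ s in (0:ℝ)..1,
        (K * (exp (s • (A + t₀ • Y)) * Y * exp ((1 - s) • (A + t₀ • Y)))).trace).re t₀ := by
  have h := Complex.reCLM.hasFDerivAt.comp_hasDerivAt t₀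
    (hasDerivAt_trace_mul_exp_add_smul K A Y t₀)
  rw [Complex.reCLM_apply] at h
  exact h.congr_of_eventuallyEq (Eventually.of_forall fun t => rfl)


/-- The Duhamel derivative `t ↦ Re ∫₀¹ Tr(K e^{s(A+tY)} Y e^{(1−s)(A+tY)}) ds` is continuous (joint
continuity of the integrand, as in the tree's `continuous_duhamel_increment`). [folklore] -/
theorem continuous_re_integral_trace_mul (K A Y : Matrix m m ℂ) :
    Continuous fun t : ℝ => (∫ s in (0:ℝ)..1,
      (K * (exp (s • (A + t • Y)) * Y * exp ((1 - s) • (A + t • Y)))).trace).re := by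
  letI : NormedAlgebra ℚ (Matrix m m ℂ) := .restrictScalars ℚ ℂ _
  refine Complex.continuous_re.comp ?_
  refine intervalIntegral.continuous_parametric_intervalIntegral_of_continuous' ?_ 0 1
  show Continuous fun q : ℝ × ℝ =>
    (K * (exp (q.2 • (A + q.1 • Y)) * Y * exp ((1 - q.2) • (A + q.1 • Y)))).trace
  have hc : Continuous fun q : ℝ × ℝ =>
      K * (exp (q.2 • (A + q.1 • Y)) * Y * exp ((1 - q.2) • (A + q.1 • Y))) := by
    fun_prop
  exact hc.matrix_trace


/-- `t ↦ Re Tr e^{A+tY}` is continuous (it is differentiable). [folklore] -/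
theorem continuous_re_trace_exp_add_smul (A Y : Matrix m m ℂ) :
    Continuous fun t : ℝ => (exp (A + t • Y)).trace.re :=
  continuous_iff_continuousAt.2 fun t => (hasDerivAt_re_trace_exp_add_smul A Y t).continuousAt


/-- `t ↦ Re Tr(K e^{A+tY})` is continuous (it is differentiable). [folklore] -/
theorem continuous_re_trace_const_mul_exp_add_smul (K A Y : Matrix m m ℂ) :
    Continuous fun t : ℝ => (K * exp (A + t • Y)).trace.re :=
  continuous_iff_continuousAt.2 fun t =>
    (hasDerivAt_re_trace_const_mul_exp_add_smul K A Y t).continuousAt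


/-- Second-derivative test at a local maximum, pointwise form: if `g ≤ g 0` near `0`, `g` is
differentiable everywhere with derivative `g'`, and `g'` has derivative `d` at `0`, then `d ≤ 0`
(if `d > 0`, Mathlib's `isLocalMin_of_deriv_deriv_pos` makes `0` also a local minimum, so `g` is
locally constant and `d = 0`). [folklore] -/
theorem deriv2_nonpos_of_eventually_le {g g' : ℝ → ℝ} {d : ℝ} (hle : ∀ᶠ t in 𝓝 0, g t ≤ g 0)
    (hg : ∀ t, HasDerivAt g (g' t) t) (hg' : HasDerivAt g' d 0) : d ≤ 0 := by
  by_contra hpos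
  push Not at hpos
  have hderiv : deriv g = g' := funext fun t => (hg t).deriv
  have hmax : IsLocalMax g 0 := hle
  have hd0 : deriv g 0 = 0 := hmax.deriv_eq_zero
  have hdd : deriv (deriv g) 0 = d := by rw [hderiv]; exact hg'.deriv
  have hmin : IsLocalMin g 0 :=
    isLocalMin_of_deriv_deriv_pos (by rw [hdd]; exact hpos) hd0 (hg 0).continuousAt
  have hconst : g =ᶠ[𝓝 0] fun _ => g 0 :=
    ((show ∀ᶠ t in 𝓝 0, g 0 ≤ g t from hmin).and hle).mono fun t ht => le_antisymm ht.2 ht.1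
  have hdz : deriv g =ᶠ[𝓝 0] fun _ => 0 := by
    have h2 : ∀ᶠ t in 𝓝 0, g =ᶠ[𝓝 t] fun _ => g 0 := eventually_eventuallyEq_nhds.2 hconst
    exact h2.mono fun t ht => by rw [ht.deriv_eq, deriv_const]
  have hdd0 : deriv (deriv g) 0 = 0 := by rw [hdz.deriv_eq, deriv_const]
  linarith


/-- Product rule at a point where one factor vanishes to second order: if `u 0 = 0`,
`u'(0) = 0` and `v` is merely continuous at `0`, then `u·v` has derivative `0` at `0`
(`o(t)·O(1) = o(t)`). [folklore] -/
theorem hasDerivAt_mul_of_hasDerivAt_zero {u v : ℝ → ℝ} (hu : HasDerivAt u 0 0) (hu0 : u 0 = 0)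
    (hv : ContinuousAt v 0) : HasDerivAt (fun t => u t * v t) 0 0 := by
  rw [hasDerivAt_iff_isLittleO_nhds_zero] at hu ⊢
  simp only [zero_add, hu0, smul_zero, sub_zero, zero_mul] at hu ⊢
  have hv' : v =O[𝓝 0] (fun _ => (1 : ℝ)) := Filter.Tendsto.isBigO_one ℝ hv
  have h := hu.mul_isBigO hv'
  simpa using h


/-! ### The engine: stiffness ≤ half the Kubo curvature -/

/-- **Stiffness coefficient ≤ half the Kubo curvature of the free energy.** For Hermitian
`H, K, J` (nonempty finite index type), `β > 0`, `θ₀ > 0`, `c ≠ 0`: if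
`β ρ θ² ≤ log Z_β(H) − log Z_β(H + (1 − cos(θc)) K + sin(θc) J)` for `|θ| ≤ θ₀`, then
`ρ ≤ c² (½ Re⟨K⟩_β − (β/2) Re (J,J)_β)` with `(J,J)_β = duhamel β H J J`, and `Re⟨J⟩_β = 0`.
See the module docstring for the proof. [cite: ScalapinoWhiteZhang1993, §II] -/
theorem stiffness_le_half_kin_sub_duhamel [Nonempty m] {H K J : Matrix m m ℂ} (hH : H.IsHermitian)
    (hK : K.IsHermitian) (hJ : J.IsHermitian) {β ρ θ₀ c : ℝ} (hβ : 0 < β) (hθ₀ : 0 < θ₀)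
    (hc : c ≠ 0)
    (hyp : ∀ θ : ℝ, |θ| ≤ θ₀ → β * ρ * θ ^ 2 ≤ Real.log (partitionFn β H).re -
        Real.log (partitionFn β (H + ((1 - Real.cos (θ * c) : ℝ) : ℂ) • K +
          ((Real.sin (θ * c) : ℝ) : ℂ) • J)).re) :
    ρ ≤ c ^ 2 * ((gibbsState β H K).re / 2 - β / 2 * (duhamel β H J J).re) ∧
      (gibbsState β H J).re = 0 := by
  -- abbreviations: `A = -βH`, `Y = -βJ`, the line `s ↦ H + sJ`
  set A : Matrix m m ℂ := -(β : ℂ) • H with hA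
  set Y : Matrix m m ℂ := -(β : ℂ) • J with hY
  -- a real multiple of a Hermitian matrix is Hermitian (inlined; the tree has this under several
  -- names, e.g. `Matrix.IsHermitian.ofReal_smul` in `XYOrderInfraredProofs`, not imported here)
  have hsm : ∀ {V : Matrix m m ℂ}, V.IsHermitian → ∀ r : ℝ, ((r : ℂ) • V).IsHermitian :=
    fun hV r => by rw [IsHermitian, conjTranspose_smul, hV.eq]; simp
  have hHs : ∀ s : ℝ, (H + ((s : ℝ) : ℂ) • J).IsHermitian := fun s => hH.add (hsm hJ s)
  have hgw : ∀ s : ℝ, gibbsWeight β (H + ((s : ℝ) : ℂ) • J) = exp (A + s • Y) := by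
    intro s
    rw [gibbsWeight, hA, hY, ← Complex.coe_smul]
    congr 1
    module
  set Z : ℝ → ℝ := fun s => (exp (A + s • Y)).trace.re with hZ
  set Z₁ : ℝ → ℝ := fun s => (Y * exp (A + s • Y)).trace.re with hZ₁
  set N : ℝ → ℝ := fun s => (K * exp (A + s • Y)).trace.re with hN
  set N₁ : ℝ → ℝ := fun s => (∫ u in (0:ℝ)..1,
    (K * (exp (u • (A + s • Y)) * Y * exp ((1 - u) • (A + s • Y)))).trace).re with hN₁
  set I₂ : ℂ := ∫ u in (0:ℝ)..1,
    (J * gibbsWeight (u * β) H * J * gibbsWeight ((1 - u) * β) H).trace with hI₂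
  -- `Z = Σ e^{-βEᵢ} > 0`, and the thermal quantities on the line
  have hZsum : ∀ s, Z s = ∑ i, Real.exp (-(β * (hHs s).eigenvalues i)) := by
    intro s
    simp only [hZ]
    rw [← hgw, ← partitionFn, (hHs s).partitionFn_eq_ofReal, Complex.ofReal_re]
  have hZpos : ∀ s, 0 < Z s := fun s => by rw [hZsum]; exact (hHs s).sum_exp_pos β
  have hZre : ∀ s, (partitionFn β (H + ((s : ℝ) : ℂ) • J)).re = Z s := by
    intro s; simp only [hZ]; rw [partitionFn, hgw]
  have hEK : ∀ s, (gibbsState β (H + ((s : ℝ) : ℂ) • J) K).re = N s / Z s := by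
    intro s
    rw [(hHs s).re_gibbsState, ← hZsum, trace_mul_comm, hgw, inv_mul_eq_div]
  have hZ0 : (partitionFn β H).re = Z 0 := by
    have h := hZre 0; simpa using h
  have hEK0 : (gibbsState β H K).re = N 0 / Z 0 := by
    have h := hEK 0; simpa using h
  have hSum : ∑ i, Real.exp (-(β * hH.eigenvalues i)) = Z 0 := by
    rw [← hZ0, hH.partitionFn_eq_ofReal, Complex.ofReal_re]
  have hduh : (duhamel β H J J).re = I₂.re / Z 0 := by
    rw [hH.re_duhamel, hSum, inv_mul_eq_div]
  -- the function `g ≤ 0` near `0`, `g 0 = 0`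
  set sf : ℝ → ℝ := fun θ => Real.sin (θ * c) with hsf
  set α : ℝ → ℝ := fun θ => 1 - Real.cos (θ * c) with hα
  set E : ℝ → ℝ := fun θ => N (sf θ) / Z (sf θ) with hE
  set g : ℝ → ℝ := fun θ => Real.log (Z (sf θ)) - β * (α θ * E θ) +
    β * ρ * θ ^ 2 - Real.log (Z 0) with hg
  have hs0 : sf 0 = 0 := by simp [hsf]
  have hα0 : α 0 = 0 := by simp [hα]
  have hg0 : g 0 = 0 := by simp [hg, hs0, hα0]
  have hgle : ∀ θ, |θ| ≤ θ₀ → g θ ≤ 0 := by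
    intro θ hθ
    have h1 := hyp θ hθ
    have hPB := log_partitionFn_sub_le_log_partitionFn_add (hHs (sf θ))
      (hsm hK (α θ)) β
    have hperm : H + ((sf θ : ℝ) : ℂ) • J + ((α θ : ℝ) : ℂ) • K =
        H + ((1 - Real.cos (θ * c) : ℝ) : ℂ) • K + ((Real.sin (θ * c) : ℝ) : ℂ) • J := by
      simp only [hsf, hα]; abel
    rw [hperm, map_smul, smul_eq_mul, Complex.re_ofReal_mul, hEK, hZre] at hPB
    rw [hZ0] at h1
    have hgθ : g θ = Real.log (Z (sf θ)) - β * (α θ * (N (sf θ) / Z (sf θ))) +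
        β * ρ * θ ^ 2 - Real.log (Z 0) := rfl
    rw [hgθ]
    linarith
  -- first derivatives everywhere
  have hZd : ∀ s, HasDerivAt Z (Z₁ s) s := fun s => hasDerivAt_re_trace_exp_add_smul A Y s
  have hNd : ∀ s, HasDerivAt N (N₁ s) s := fun s =>
    hasDerivAt_re_trace_const_mul_exp_add_smul K A Y s
  have hZ₁d : HasDerivAt Z₁ (β ^ 2 * I₂.re) 0 := by
    have h := hasDerivAt_re_trace_mul_exp_add_smul A Y 0
    simp only [zero_smul, add_zero] at h
    refine h.congr_deriv ?_
    have key : ∀ u : ℝ, (Y * (exp (u • A) * Y * exp ((1 - u) • A))).trace =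
        (β : ℂ) ^ 2 * (J * gibbsWeight (u * β) H * J * gibbsWeight ((1 - u) * β) H).trace := by
      intro u
      rw [hA, hY, exp_smul_neg_smul_eq_gibbsWeight, exp_smul_neg_smul_eq_gibbsWeight]
      simp only [Matrix.smul_mul, Matrix.mul_smul, trace_smul, smul_eq_mul, Matrix.mul_assoc]
      ring
    simp_rw [key]
    rw [intervalIntegral.integral_const_mul, ← hI₂,
      show (β : ℂ) ^ 2 = ((β ^ 2 : ℝ) : ℂ) by push_cast; ring, Complex.re_ofReal_mul]
  have hsd : ∀ θ, HasDerivAt sf (Real.cos (θ * c) * c) θ := fun θ => by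
    have h := ((hasDerivAt_id θ).mul_const c).sin
    simpa using h
  have hαd : ∀ θ, HasDerivAt α (Real.sin (θ * c) * c) θ := fun θ => by
    have h := (((hasDerivAt_id θ).mul_const c).cos).const_sub 1
    simpa using h
  set E' : ℝ → ℝ := fun θ => (N₁ (sf θ) * (Real.cos (θ * c) * c) * Z (sf θ) -
      N (sf θ) * (Z₁ (sf θ) * (Real.cos (θ * c) * c))) / Z (sf θ) ^ 2 with hE'
  have hEd : ∀ θ, HasDerivAt E (E' θ) θ := fun θ => by
    have h1 : HasDerivAt (fun θ => N (sf θ)) (N₁ (sf θ) * (Real.cos (θ * c) * c)) θ :=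
      (hNd (sf θ)).comp θ (hsd θ)
    have h2 : HasDerivAt (fun θ => Z (sf θ)) (Z₁ (sf θ) * (Real.cos (θ * c) * c)) θ :=
      (hZd (sf θ)).comp θ (hsd θ)
    exact h1.div h2 (hZpos _).ne'
  set g' : ℝ → ℝ := fun θ => Z₁ (sf θ) * (Real.cos (θ * c) * c) / Z (sf θ) -
      β * (Real.sin (θ * c) * c * E θ + α θ * E' θ) + β * ρ * (2 * θ) with hg'
  have hgd : ∀ θ, HasDerivAt g (g' θ) θ := fun θ => by
    have h1 : HasDerivAt (fun θ => Real.log (Z (sf θ)))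
        (Z₁ (sf θ) * (Real.cos (θ * c) * c) / Z (sf θ)) θ :=
      ((hZd (sf θ)).comp θ (hsd θ)).log (hZpos _).ne'
    have h2 : HasDerivAt (fun θ => α θ * E θ) (Real.sin (θ * c) * c * E θ + α θ * E' θ) θ :=
      (hαd θ).mul (hEd θ)
    have h3 : HasDerivAt (fun θ : ℝ => β * ρ * θ ^ 2) (β * ρ * (2 * θ)) θ := by
      have h := (hasDerivAt_pow 2 θ).const_mul (β * ρ)
      simpa using h
    exact ((h1.sub (h2.const_mul β)).add h3).sub_const (Real.log (Z 0))
  -- local maximum at `0`: first derivative vanishes, i.e. `⟨J⟩ = 0`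
  have hev : ∀ᶠ θ in 𝓝 (0:ℝ), g θ ≤ g 0 := by
    rw [hg0]
    have hI : Set.Icc (-θ₀) θ₀ ∈ 𝓝 (0 : ℝ) := Icc_mem_nhds (by linarith) hθ₀
    exact Filter.mem_of_superset hI fun θ hθ => hgle θ (abs_le.2 ⟨hθ.1, hθ.2⟩)
  have hmax : IsLocalMax g 0 := hev
  have hZ₁0 : Z₁ 0 = 0 := by
    have h := hmax.hasDerivAt_eq_zero (hgd 0)
    have h' : g' 0 = Z₁ 0 * c / Z 0 := by
      simp [hg', hs0, hα0]
    rw [h'] at h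
    rcases div_eq_zero_iff.1 h with h | h
    · exact (mul_eq_zero.1 h).resolve_right hc
    · exact absurd h (hZpos 0).ne'
  have hJgw : (J * gibbsWeight β H).trace.re = 0 := by
    have h : Z₁ 0 = -(β * (J * gibbsWeight β H).trace.re) := by
      have e : exp A = gibbsWeight β H := by rw [hA]; rfl
      simp only [hZ₁, zero_smul, add_zero]
      rw [e, hY, Matrix.smul_mul, trace_smul, smul_eq_mul, neg_mul, Complex.neg_re,
        Complex.re_ofReal_mul]
    rw [hZ₁0] at h
    have h2 : β * (J * gibbsWeight β H).trace.re = 0 := by linarith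
    exact (mul_eq_zero.1 h2).resolve_left hβ.ne'
  -- second derivative at `0`
  have hs'd : HasDerivAt (fun θ => Real.cos (θ * c) * c) 0 0 := by
    have h := (((hasDerivAt_id (0:ℝ)).mul_const c).cos).mul_const c
    simpa using h
  have hα'd : HasDerivAt (fun θ => Real.sin (θ * c) * c) (c * c) 0 := by
    have h := (((hasDerivAt_id (0:ℝ)).mul_const c).sin).mul_const c
    simpa using h
  have hf1 : HasDerivAt (fun θ => Z₁ (sf θ) * (Real.cos (θ * c) * c))
      (β ^ 2 * I₂.re * (Real.cos (0 * c) * c) * (Real.cos (0 * c) * c) + Z₁ (sf 0) * 0) 0 := by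
    have hz : HasDerivAt Z₁ (β ^ 2 * I₂.re) (sf 0) := by rw [hs0]; exact hZ₁d
    exact (hz.comp 0 (hsd 0)).mul hs'd
  have hf2 : HasDerivAt (fun θ => Z (sf θ)) (Z₁ (sf 0) * (Real.cos (0 * c) * c)) 0 :=
    (hZd (sf 0)).comp 0 (hsd 0)
  have hquot := hf1.div hf2 (hZpos _).ne'
  have hT1 : HasDerivAt (fun θ => Real.sin (θ * c) * c * E θ)
      (c * c * E 0 + Real.sin (0 * c) * c * E' 0) 0 := hα'd.mul (hEd 0)
  have hE'c : ContinuousAt E' 0 := by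
    have hZc : Continuous Z := continuous_re_trace_exp_add_smul A Y
    have hZ₁c : Continuous Z₁ := continuous_iff_continuousAt.2 fun s =>
      (hasDerivAt_re_trace_mul_exp_add_smul A Y s).continuousAt
    have hNc : Continuous N := continuous_re_trace_const_mul_exp_add_smul K A Y
    have hN₁c : Continuous N₁ := continuous_re_integral_trace_mul K A Y
    have hsc : Continuous sf := by simp only [hsf]; fun_prop
    have hcos : Continuous fun θ : ℝ => Real.cos (θ * c) * c := by fun_prop
    have hE'cont : Continuous E' := by
      simp only [hE']
      refine Continuous.div ?_ ((hZc.comp hsc).pow 2) (fun θ => pow_ne_zero 2 (hZpos _).ne')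
      exact (((hN₁c.comp hsc).mul hcos).mul (hZc.comp hsc)).sub
        ((hNc.comp hsc).mul ((hZ₁c.comp hsc).mul hcos))
    exact hE'cont.continuousAt
  have hT2 : HasDerivAt (fun θ => α θ * E' θ) 0 0 :=
    hasDerivAt_mul_of_hasDerivAt_zero (by have h := hαd 0; simpa using h) hα0 hE'c
  have hQ : HasDerivAt (fun θ : ℝ => β * ρ * (2 * θ)) (β * ρ * 2) 0 := by
    have h := ((hasDerivAt_id (0:ℝ)).const_mul 2).const_mul (β * ρ)
    simpa using h
  have hE0 : E 0 = N 0 / Z 0 := by simp [hE, hs0]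
  have hg'd : HasDerivAt g'
      (c ^ 2 * (β ^ 2 * (I₂.re / Z 0) - β * (N 0 / Z 0)) + 2 * β * ρ) 0 := by
    have h := (hquot.sub ((hT1.add hT2).const_mul β)).add hQ
    refine h.congr_deriv ?_
    simp only [hs0, hZ₁0, hE0, Real.sin_zero, Real.cos_zero, zero_mul, mul_zero, one_mul,
      add_zero, sub_zero]
    have hZ0ne := (hZpos 0).ne'
    field_simp
  have hd := deriv2_nonpos_of_eventually_le hev hgd hg'd
  -- conclusion
  refine ⟨?_, ?_⟩
  · rw [hEK0, hduh]
    have key : c ^ 2 * β * (I₂.re / Z 0) - c ^ 2 * (N 0 / Z 0) + 2 * ρ ≤ 0 := by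
      by_contra hcon
      push Not at hcon
      have h2 := mul_pos hβ hcon
      nlinarith [hd, h2]
    nlinarith [key]
  · rw [hH.re_gibbsState, trace_mul_comm, hJgw, mul_zero]


/-! ### Node -/

/-- **Kubo-curvature stiffness ceiling (finite-dimensional engine)** — conjecture node, PROVED
below (`kuboCurvatureStiffnessCeiling_holds`): for Hermitian `H, K, J` on a nonempty finite index
type, `0 < β`, `0 < θ₀`, `c ≠ 0`, stiffness of `log Z` along `H + (1 − cos(θc))K + sin(θc)J`
with coefficient `βρ` on `|θ| ≤ θ₀` forces `Re⟨J⟩_β = 0` and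
`ρ ≤ c² (Re⟨K⟩_β / 2 − β/2 · Re duhamel β H J J)`. [cite: ScalapinoWhiteZhang1993, §II] -/
@[conjecture] def KuboCurvatureStiffnessCeiling : Prop :=
  ∀ (m : Type) [Fintype m] [DecidableEq m] [Nonempty m] (H K J : Matrix m m ℂ),
    H.IsHermitian → K.IsHermitian → J.IsHermitian → ∀ (β ρ θ₀ c : ℝ), 0 < β → 0 < θ₀ → c ≠ 0 →
    (∀ θ : ℝ, |θ| ≤ θ₀ → β * ρ * θ ^ 2 ≤ Real.log (partitionFn β H).re -
        Real.log (partitionFn β (H + ((1 - Real.cos (θ * c) : ℝ) : ℂ) • K +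
          ((Real.sin (θ * c) : ℝ) : ℂ) • J)).re) →
    ρ ≤ c ^ 2 * ((gibbsState β H K).re / 2 - β / 2 * (duhamel β H J J).re) ∧
      (gibbsState β H J).re = 0

/-- Proof of the node `KuboCurvatureStiffnessCeiling`. -/
theorem kuboCurvatureStiffnessCeiling_holds : KuboCurvatureStiffnessCeiling := by
  intro m _ _ _ H K J hH hK hJ β ρ θ₀ c hβ hθ₀ hc hyp
  exact stiffness_le_half_kin_sub_duhamel hH hK hJ hβ hθ₀ hc hyp

end Summit.HubbardSuperconductivity.HubbardLadder.Bounds
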